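import Summits.AnomalousDissipation.AnomalousDissipation.Theorems.SolenoidalFractalHomogenisationLagrangianCarrierConstructionTowerWindows
import Literature.Analysis.FunctionSpaces.FlatTorusProofs
import HarnessLib

/-!
# K3L `LagrangianCarrierConstruction` (stmt-AnomalousDissipation-24913), line `birth`, stub `stub_flowsL`:
# joint continuity along the Lagrangian tower (helper; `--supports stmt-AnomalousDissipation-24913`)

Summits-side helper file (everything proved; no definitions, no named facts). Towards clauses (L1) (the level fields are jointly continuous in
`(t, x)`) and (F1a) (the displacements are jointly continuous) of `LevelRegular`:
* the space derivative of a map jointly `C¹` on a CLOSED time slab is jointly continuous on the closed slab (boundary times included);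
* one-sided closed slabs at every time therefore give GLOBAL joint continuity of `(t, z) ↦ A t z` and of `(t, z) ↦ D(A t)(z)`;
* the inserted velocity read in a FIXED frame, `(t, z) ↦ D(A t ∘ A s⁻¹)(A s (A t⁻¹ z)) (v t (A s (A t⁻¹ z)))`, is then jointly continuous;
* joint continuity descends from `ℝ × ℝ^d` to `ℝ × 𝕋^d` along `id × proj` (an open quotient map) for maps that are lattice periodic in space.
NOT a proof of anomalous dissipation (F-D1 is a frontier formal rung).
-/

set_option linter.dupNamespace false

noncomputable section

namespace Summit.AnomalousDissipation.AnomalousDissipation.Theorems.SolenoidalFractalHomogenisation.LagrangianCarrierConstruction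

open Set Function Filter Topology Metric
open scoped NNReal
open Literature.Analysis.ODE Literature.Analysis.FunctionSpaces

section Slab

variable {V : Type*} [NormedAddCommGroup V] [NormedSpace ℝ V]

/-- **The space derivative of a map jointly `C¹` on a closed time slab is jointly continuous there** (boundary times included: the slice
derivative is the within-derivative composed with the inclusion of the space factor). [folklore] -/
theorem continuousOn_fderiv_slice_slab {Φ : ℝ → V → V} {a b : ℝ} (hab : a < b)
    (h : ContDiffOn ℝ 1 (fun p : ℝ × V => Φ p.1 p.2) (Icc a b ×ˢ univ)) :
    ContinuousOn (fun p : ℝ × V => fderiv ℝ (Φ p.1) p.2) (Icc a b ×ˢ univ) := by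
  have hU : UniqueDiffOn ℝ (Icc a b ×ˢ (univ : Set V)) := (uniqueDiffOn_Icc hab).prod uniqueDiffOn_univ
  have hcont := (h.continuousOn_fderivWithin hU le_rfl).clm_comp (continuousOn_const (c := ContinuousLinearMap.inr ℝ ℝ V))
  refine hcont.congr fun p hp => ?_
  -- the slice derivative at `p` is the within-derivative composed with `inr`
  have hd : HasFDerivWithinAt (fun q : ℝ × V => Φ q.1 q.2) (fderivWithin ℝ (fun q : ℝ × V => Φ q.1 q.2) (Icc a b ×ˢ univ) p)
      (Icc a b ×ˢ univ) p := (h.differentiableOn (by simp) p hp).hasFDerivWithinAt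
  have hi : HasFDerivWithinAt (fun z : V => ((p.1, z) : ℝ × V)) (ContinuousLinearMap.inr ℝ ℝ V) univ p.2 :=
    (hasFDerivAt_prodMk_right p.1 p.2).hasFDerivWithinAt
  have hcomp := hd.comp p.2 hi (fun z _ => show ((p.1, z) : ℝ × V) ∈ Icc a b ×ˢ (univ : Set V) from ⟨hp.1, mem_univ _⟩)
  have hcomp' : HasFDerivAt (fun z : V => Φ p.1 z)
      ((fderivWithin ℝ (fun q : ℝ × V => Φ q.1 q.2) (Icc a b ×ˢ univ) p).comp (ContinuousLinearMap.inr ℝ ℝ V)) p.2 :=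
    hcomp.hasFDerivAt_of_univ
  exact hcomp'.fderiv

/-- **Global joint continuity from one-sided closed slabs**: of the map itself … [folklore] -/
theorem continuous_uncurry_of_slabs {Φ : ℝ → V → V}
    (h3 : ∀ r, ∃ ε > 0, ContDiffOn ℝ 1 (fun p : ℝ × V => Φ p.1 p.2) (Icc r (r + ε) ×ˢ univ) ∧
      ContDiffOn ℝ 1 (fun p : ℝ × V => Φ p.1 p.2) (Icc (r - ε) r ×ˢ univ)) :
    Continuous fun p : ℝ × V => Φ p.1 p.2 := by
  refine continuous_iff_continuousAt.2 fun p => ?_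
  obtain ⟨ε, hε, hR, hL⟩ := h3 p.1
  have hU : ContinuousOn (fun p : ℝ × V => Φ p.1 p.2) ((Icc (p.1 - ε) p.1 ×ˢ univ) ∪ (Icc p.1 (p.1 + ε) ×ˢ univ)) :=
    hL.continuousOn.union_of_isClosed hR.continuousOn (isClosed_Icc.prod isClosed_univ) (isClosed_Icc.prod isClosed_univ)
  refine hU.continuousAt (Filter.mem_of_superset (prod_mem_nhds (Icc_mem_nhds (show p.1 - ε < p.1 by linarith)
    (show p.1 < p.1 + ε by linarith)) univ_mem) ?_)
  rintro q ⟨hq, -⟩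
  rcases le_or_gt q.1 p.1 with h | h
  · exact Or.inl ⟨⟨hq.1, h⟩, mem_univ _⟩
  · exact Or.inr ⟨⟨h.le, hq.2⟩, mem_univ _⟩

/-- … and of its space derivative. [folklore] -/
theorem continuous_fderiv_slice_of_slabs {Φ : ℝ → V → V}
    (h3 : ∀ r, ∃ ε > 0, ContDiffOn ℝ 1 (fun p : ℝ × V => Φ p.1 p.2) (Icc r (r + ε) ×ˢ univ) ∧
      ContDiffOn ℝ 1 (fun p : ℝ × V => Φ p.1 p.2) (Icc (r - ε) r ×ˢ univ)) :
    Continuous fun p : ℝ × V => fderiv ℝ (Φ p.1) p.2 := by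
  refine continuous_iff_continuousAt.2 fun p => ?_
  obtain ⟨ε, hε, hR, hL⟩ := h3 p.1
  have hU : ContinuousOn (fun p : ℝ × V => fderiv ℝ (Φ p.1) p.2)
      ((Icc (p.1 - ε) p.1 ×ˢ univ) ∪ (Icc p.1 (p.1 + ε) ×ˢ univ)) :=
    (continuousOn_fderiv_slice_slab (by linarith) hL).union_of_isClosed (continuousOn_fderiv_slice_slab (by linarith) hR)
      (isClosed_Icc.prod isClosed_univ) (isClosed_Icc.prod isClosed_univ)
  refine hU.continuousAt (Filter.mem_of_superset (prod_mem_nhds (Icc_mem_nhds (show p.1 - ε < p.1 by linarith)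
    (show p.1 < p.1 + ε by linarith)) univ_mem) ?_)
  rintro q ⟨hq, -⟩
  rcases le_or_gt q.1 p.1 with h | h
  · exact Or.inl ⟨⟨hq.1, h⟩, mem_univ _⟩
  · exact Or.inr ⟨⟨h.le, hq.2⟩, mem_univ _⟩

/-- **The inserted velocity in a fixed frame is jointly continuous everywhere** when the inverses of the coarse flow and its space
derivative are jointly continuous and the Eulerian field is. [folklore] -/
theorem continuous_inserted_fixed_frame (A : ℝ → V ≃ V) (v : ℝ → V → V) (s : ℝ)
    (hA' : Continuous fun p : ℝ × V => (A p.1).symm p.2)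
    (hDA : Continuous fun p : ℝ × V => fderiv ℝ (A p.1) p.2)
    (hA1 : ∀ t, ContDiff ℝ 1 (A t)) (hAs : ContDiff ℝ 1 (A s).symm) (hvc : Continuous (uncurry v)) :
    Continuous fun p : ℝ × V => fderiv ℝ (fun y => A p.1 ((A s).symm y)) (A s ((A p.1).symm p.2))
      (v p.1 (A s ((A p.1).symm p.2))) := by
  have hexp : (fun p : ℝ × V => fderiv ℝ (fun y => A p.1 ((A s).symm y)) (A s ((A p.1).symm p.2))
      (v p.1 (A s ((A p.1).symm p.2)))) = fun p : ℝ × V =>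
      (fderiv ℝ (A p.1) ((A s).symm (A s ((A p.1).symm p.2))))
        ((fderiv ℝ (A s).symm (A s ((A p.1).symm p.2))) (v p.1 (A s ((A p.1).symm p.2)))) := by
    funext p
    have e : fderiv ℝ (fun y => A p.1 ((A s).symm y)) (A s ((A p.1).symm p.2)) =
        (fderiv ℝ (A p.1) ((A s).symm (A s ((A p.1).symm p.2)))).comp (fderiv ℝ (A s).symm (A s ((A p.1).symm p.2))) :=
      fderiv_comp _ (((hA1 p.1).differentiable (by simp)) _) ((hAs.differentiable (by simp)) _)
    rw [e]
    rfl
  rw [hexp]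
  have hq : Continuous fun p : ℝ × V => A s ((A p.1).symm p.2) := (hA1 s).continuous.comp hA'
  have hy : Continuous fun p : ℝ × V => (A s).symm (A s ((A p.1).symm p.2)) := hAs.continuous.comp hq
  have hL1 : Continuous fun p : ℝ × V => fderiv ℝ (A p.1) ((A s).symm (A s ((A p.1).symm p.2))) :=
    hDA.comp (continuous_fst.prodMk hy)
  have hL2 : Continuous fun p : ℝ × V => fderiv ℝ (A s).symm (A s ((A p.1).symm p.2)) :=
    (hAs.continuous_fderiv (by simp)).comp hq
  have hw : Continuous fun p : ℝ × V => v p.1 (A s ((A p.1).symm p.2)) := hvc.comp (continuous_fst.prodMk hq)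
  exact hL1.clm_apply (hL2.clm_apply hw)

end Slab

section Descent

variable {d : Type*} [Fintype d] [DecidableEq d] {F : Type*} [TopologicalSpace F]

omit [Fintype d] [DecidableEq d] in
/-- `id × proj : ℝ × ℝ^d → ℝ × 𝕋^d` is an open quotient map. [folklore] -/
theorem isOpenQuotientMap_id_prod_proj :
    IsOpenQuotientMap (Prod.map (id : ℝ → ℝ) (Torus.proj : EuclideanSpace ℝ d → UnitAddTorus d)) :=
  ⟨surjective_id.prodMap Torus.proj_surjective, continuous_id.prodMap Torus.continuous_proj,
    IsOpenMap.id.prodMap Torus.isOpenQuotientMap_proj.isOpenMap⟩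

/-- **Descent of joint continuity to the torus**: if `G` is jointly continuous on `ℝ × ℝ^d` and lattice periodic in space, then
`(t, x) ↦ G t (repr x)` is jointly continuous on `ℝ × 𝕋^d`. [folklore] -/
theorem continuous_uncurry_repr {G : ℝ → EuclideanSpace ℝ d → F} (hG : Continuous fun p : ℝ × EuclideanSpace ℝ d => G p.1 p.2)
    (hper : ∀ t z (k : d → ℤ), G t (z + Torus.latticeVec k) = G t z) :
    Continuous fun p : ℝ × UnitAddTorus d => G p.1 (Torus.repr p.2) := by
  rw [← isOpenQuotientMap_id_prod_proj.continuous_comp_iff]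
  have e : ((fun p : ℝ × UnitAddTorus d => G p.1 (Torus.repr p.2)) ∘ Prod.map id Torus.proj) =
      fun p : ℝ × EuclideanSpace ℝ d => G p.1 p.2 := by
    funext p
    obtain ⟨k, hk⟩ := Torus.exists_repr_proj_eq_add_latticeVec_holds p.2
    show G p.1 (Torus.repr (Torus.proj p.2)) = G p.1 p.2
    rw [hk, hper]
  rw [e]
  exact hG

end Descent

end Summit.AnomalousDissipation.AnomalousDissipation.Theorems.SolenoidalFractalHomogenisation.LagrangianCarrierConstruction

end
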